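import Summits.BirchSwinnertonDyer.Rank1Residual.Additive.N11KimAtThreePUB
import Summits.BirchSwinnertonDyer.Rank1Residual.Additive.N11KimAtThreeDeepPUB
import Literature.NumberTheory.EllipticCurves.KuriharaNumberDeepInvariants
import HarnessLib

/-!
# Rung W2 (`KimAtThreeKolyvagin`): the leaf `N11.KimAtThreeRankZeroPUB` from its three open inputs, BY NAME

Theorems-side bridge for the ledger route `KimAtThreeKolyvagin` (D-0059 / D-0061; cell `bsd-addord`,
`run/shared/lean/pub/bsd-addord/TARGET.md` v6.8 L4.55; director-bsd INBOX 2026-08-25T19:23:15Z: route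
files may import only `Literature`, `HarnessLib`, the Statement and `Theorems/*`, while the leaf lives in
`Summits/BirchSwinnertonDyer/Rank1Residual/Additive/N11KimAtThreePUB.lean`). This module imports the leaf
and proves, once, the kernel certificate the route's deciding theorem applies:

* `kimAtThreeRankZeroPUB_of_inputs` — the rung-W2 leaf (Kim, arXiv:2505.09121, Thm 1.1/1.2 at
  `p = 3`, analytic rank `0`, `E(ℚ₃)[3] = 0`, under the `3`-adic tower hypothesis; the kim3 CELL THEOREM,
  memo `kim3/KIM3-PROOF.md` v2.4) follows from THREE open inputs, spelled INLINE as hypotheses (they are the route's crux items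
  `DeepLowerAtThree` / `DeepUpperAtThree` / `ShallowEqDeepAtTorsionFree`, definitionally) in the `∂`-vocabulary of
  `KuriharaNumberInvariants` / `KuriharaNumberDeepInvariants`:
  (L) the deep-limit LOWER inequality `∂⁽⁰⁾(δ̃) ≤ ord₃ #Ш(3) + ∂^{(∞)}_{deep}(δ̃)` (Mazur–Rubin rigidity
  for the primitive Kolyvagin system of `T₃E` at `p = 3`: Sakamoto's connectedness theorem and the
  three-class Chebotarev lemma in place of `(H.4)`/`p ≥ 5`),
  (U) the deep-limit UPPER inequality (Kato's Euler system at an additive `3` as a Kolyvagin system,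
  local lattice lemmas, the moment-calculus dictionary `x_n ↔ δ̃_n`),
  (S) SHALLOW = DEEP at `t = 0`: `∂^{(∞)}_{deep}(δ̃) ≤ ∂^{(∞)}(δ̃)` when `E(ℚ₃)[3] = 0` (normalisation
  exponent `e(Ω⁺_f) ≥ 0` of the optimally normalised integral Kato system);
  by antisymmetry in `ℕ∞` and `kuriharaPartialInfty_le_kuriharaPartialDeepInfty`.
* `kimAtThreeDeepPUB_iff_lower_and_upper` — (L) ∧ (U) is literally the cell's deep statement
  `N11.KimAtThreeDeepPUB` (bookkeeping in `ℕ∞`).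

Nothing is asserted: every input is a hypothesis by name. [cite: Kim2025RefinedTNC, Thm 1.1, Thm 1.2]
[cite: Sakamoto2024KolyvaginThree, Thm 4.4, Thm 6.7] [cite: MazurRubin2004, Thm 5.2.12]
-/

set_option autoImplicit false
set_option linter.dupNamespace false

noncomputable section

open scoped MatrixGroups ModularForm Classical

open CongruenceSubgroup WeierstrassCurve Literature.NumberTheory.EllipticCurves
  Literature.NumberTheory.EllipticCurves.ModularForms
  Literature.NumberTheory.EllipticCurves.Kim2025

namespace Summit.BirchSwinnertonDyer.BirchSwinnertonDyer.Theorems.KimAtThreeKolyvaginInputs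

open Summit.BirchSwinnertonDyer.Rank1Residual.Additive

/-- **Rung W2 from its inputs.** The leaf `N11.KimAtThreeRankZeroPUB` follows from (L), (U), (S):
(L) ∧ (U) give `∂^{(∞)}_{deep} = d` and `∂⁽⁰⁾ = ord₃ #Ш(3) + d`; (S) with
`kuriharaPartialInfty_le_kuriharaPartialDeepInfty` gives `∂^{(∞)} = d`. [cite: Kim2025RefinedTNC, Thm 1.2] -/
theorem kimAtThreeRankZeroPUB_of_inputs
    (hL : ∀ (W : WeierstrassCurve ℚ) [W.IsElliptic] [W.IsGloballyMinimal],
        (∀ n : ℕ, W.HasSurjectiveModNGaloisRep (3 ^ n : ℕ)) →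
        Finite W.sha →
        ∀ {N : ℕ} [NeZero N] (f : CuspForm (Gamma0 N) 2), IsNewformOf W f →
        (∀ r : ℚ, ratPlusSymbol f r ≠ 0 → 0 ≤ padicValRat 3 (ratPlusSymbol f r)) →
        kuriharaVanishingOrder W 3 f = 0 →
          ∃ d : ℕ, kuriharaPartialDeepInfty W 3 f = d ∧
            kuriharaPartial W 3 f 0 ≤
              ((padicValNat 3 (Nat.card (AddCommGroup.primaryComponent W.sha 3)) + d : ℕ) : ℕ∞))
    (hU : ∀ (W : WeierstrassCurve ℚ) [W.IsElliptic] [W.IsGloballyMinimal],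
        (∀ n : ℕ, W.HasSurjectiveModNGaloisRep (3 ^ n : ℕ)) →
        Finite W.sha →
        ∀ {N : ℕ} [NeZero N] (f : CuspForm (Gamma0 N) 2), IsNewformOf W f →
        (∀ r : ℚ, ratPlusSymbol f r ≠ 0 → 0 ≤ padicValRat 3 (ratPlusSymbol f r)) →
        kuriharaVanishingOrder W 3 f = 0 →
          ∃ d : ℕ, kuriharaPartialDeepInfty W 3 f = d ∧
            ((padicValNat 3 (Nat.card (AddCommGroup.primaryComponent W.sha 3)) + d : ℕ) : ℕ∞) ≤
              kuriharaPartial W 3 f 0)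
    (hS : ∀ (W : WeierstrassCurve ℚ) [W.IsElliptic] [W.IsGloballyMinimal],
        (∀ n : ℕ, W.HasSurjectiveModNGaloisRep (3 ^ n : ℕ)) →
        Nat.card {Q : (W.baseChange ℚ_[3]).toAffine.Point // (3 : ℕ) • Q = 0} = 1 →
        Finite W.sha →
        ∀ {N : ℕ} [NeZero N] (f : CuspForm (Gamma0 N) 2), IsNewformOf W f →
        (∀ r : ℚ, ratPlusSymbol f r ≠ 0 → 0 ≤ padicValRat 3 (ratPlusSymbol f r)) →
        kuriharaVanishingOrder W 3 f = 0 →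
          kuriharaPartialDeepInfty W 3 f ≤ kuriharaPartialInfty W 3 f) :
    N11.KimAtThreeRankZeroPUB := by
  intro W _ _ htower ht0 hfin N _ f hf hint hord
  obtain ⟨d, hd, hle⟩ := hL W htower hfin f hf hint hord
  obtain ⟨d', hd', hge⟩ := hU W htower hfin f hf hint hord
  have hdd : d' = d := by
    have : ((d' : ℕ) : ℕ∞) = (d : ℕ∞) := by rw [← hd', ← hd]
    exact_mod_cast this
  subst hdd
  refine ⟨d', ?_, le_antisymm hle hge⟩
  apply le_antisymm
  · calc kuriharaPartialInfty W 3 f ≤ kuriharaPartialDeepInfty W 3 f :=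
          kuriharaPartialInfty_le_kuriharaPartialDeepInfty W 3 f
      _ = d' := hd
  · calc (d' : ℕ∞) = kuriharaPartialDeepInfty W 3 f := hd.symm
      _ ≤ kuriharaPartialInfty W 3 f := hS W htower ht0 hfin f hf hint hord

/-- (L) ∧ (U) is exactly the cell's deep statement `N11.KimAtThreeDeepPUB` (memo §14 Thm A-t (ii), no
`t`-binder). [cite: Kim2025RefinedTNC, Thm 1.1] -/
theorem kimAtThreeDeepPUB_iff_lower_and_upper :
    N11.KimAtThreeDeepPUB ↔
      (∀ (W : WeierstrassCurve ℚ) [W.IsElliptic] [W.IsGloballyMinimal],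
          (∀ n : ℕ, W.HasSurjectiveModNGaloisRep (3 ^ n : ℕ)) →
          Finite W.sha →
          ∀ {N : ℕ} [NeZero N] (f : CuspForm (Gamma0 N) 2), IsNewformOf W f →
          (∀ r : ℚ, ratPlusSymbol f r ≠ 0 → 0 ≤ padicValRat 3 (ratPlusSymbol f r)) →
          kuriharaVanishingOrder W 3 f = 0 →
            ∃ d : ℕ, kuriharaPartialDeepInfty W 3 f = d ∧
              kuriharaPartial W 3 f 0 ≤
                ((padicValNat 3 (Nat.card (AddCommGroup.primaryComponent W.sha 3)) + d : ℕ) : ℕ∞)) ∧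
      (∀ (W : WeierstrassCurve ℚ) [W.IsElliptic] [W.IsGloballyMinimal],
          (∀ n : ℕ, W.HasSurjectiveModNGaloisRep (3 ^ n : ℕ)) →
          Finite W.sha →
          ∀ {N : ℕ} [NeZero N] (f : CuspForm (Gamma0 N) 2), IsNewformOf W f →
          (∀ r : ℚ, ratPlusSymbol f r ≠ 0 → 0 ≤ padicValRat 3 (ratPlusSymbol f r)) →
          kuriharaVanishingOrder W 3 f = 0 →
            ∃ d : ℕ, kuriharaPartialDeepInfty W 3 f = d ∧
              ((padicValNat 3 (Nat.card (AddCommGroup.primaryComponent W.sha 3)) + d : ℕ) : ℕ∞) ≤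
                kuriharaPartial W 3 f 0) := by
  constructor
  · intro hK
    refine ⟨?_, ?_⟩
    · intro W _ _ htower hfin N _ f hf hint hord
      obtain ⟨d, hd, h0⟩ := hK W htower hfin f hf hint hord
      exact ⟨d, hd, h0.le⟩
    · intro W _ _ htower hfin N _ f hf hint hord
      obtain ⟨d, hd, h0⟩ := hK W htower hfin f hf hint hord
      exact ⟨d, hd, h0.ge⟩
  · rintro ⟨hL, hU⟩ W _ _ htower hfin N _ f hf hint hord
    obtain ⟨d, hd, hle⟩ := hL W htower hfin f hf hint hord
    obtain ⟨d', hd', hge⟩ := hU W htower hfin f hf hint hord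
    have hdd : d' = d := by
      have : ((d' : ℕ) : ℕ∞) = (d : ℕ∞) := by rw [← hd', ← hd]
      exact_mod_cast this
    subst hdd
    exact ⟨d', hd, le_antisymm hle hge⟩

/-- Sanity edge: the leaf also follows from the deep statement plus (S) alone. -/
theorem kimAtThreeRankZeroPUB_of_deep_of_shallow (hK : N11.KimAtThreeDeepPUB)
    (hS : ∀ (W : WeierstrassCurve ℚ) [W.IsElliptic] [W.IsGloballyMinimal],
        (∀ n : ℕ, W.HasSurjectiveModNGaloisRep (3 ^ n : ℕ)) →
        Nat.card {Q : (W.baseChange ℚ_[3]).toAffine.Point // (3 : ℕ) • Q = 0} = 1 →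
        Finite W.sha →
        ∀ {N : ℕ} [NeZero N] (f : CuspForm (Gamma0 N) 2), IsNewformOf W f →
        (∀ r : ℚ, ratPlusSymbol f r ≠ 0 → 0 ≤ padicValRat 3 (ratPlusSymbol f r)) →
        kuriharaVanishingOrder W 3 f = 0 →
          kuriharaPartialDeepInfty W 3 f ≤ kuriharaPartialInfty W 3 f) :
    N11.KimAtThreeRankZeroPUB :=
  kimAtThreeRankZeroPUB_of_inputs (kimAtThreeDeepPUB_iff_lower_and_upper.mp hK).1
    (kimAtThreeDeepPUB_iff_lower_and_upper.mp hK).2 hS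

end Summit.BirchSwinnertonDyer.BirchSwinnertonDyer.Theorems.KimAtThreeKolyvaginInputs

end
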